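import Literature.NumberTheory.PAdicHodge.DeRhamOrdinaryExtension
import Literature.NumberTheory.PAdicHodge.DualExpElliptic
import Literature.NumberTheory.EllipticCurves.OrdinaryReductionTateModuleProofs
import Literature.NumberTheory.GaloisRepresentations.AbsGaloisGroupCompact
import HarnessLib

/-!
# `V_pE` is de Rham at a place of good ORDINARY reduction (hDR, sector (i), number-field completions)

Topic `Literature/NumberTheory/PAdicHodge`; namespace `Literature.NumberTheory.PAdicHodge`. THEOREMS ONLY (no definition,
no named fact, no instance, no `sorry`).

The glue between two tree theorems:
* the ORDINARY FILTRATION of the Tate module (Greenberg 1991 §2 / Serre 1972 §1.11 Prop. 11; tree THEOREM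
  `Literature.NumberTheory.EllipticCurves.ellipticOrdinaryReduction_tateModule_filtration_holds`): for an elliptic curve
  `W` over a number field `K` and a place `v ∣ p` of good ordinary reduction (`p ∤ a_v`) there is a `Γ_{K_v}`-stable
  `ℚ_p`-line `L ≤ V_pW` on which the inertia group acts through `χ_cyclo` and such that inertia acts trivially on
  `V_pW / L`;
* ORDINARY TWO-STEP REPRESENTATIONS ARE DE RHAM (Bloch–Kato 1990 Cor. 3.8.4 / Ex. 3.9, Perrin-Riou 1994; tree THEOREM
  `isDeRham_of_ordinary`, file `DeRhamOrdinaryExtension`): `N ≤ M` with `Γ_F` acting through `η₁ χ` on `N` and through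
  `η₂` on `M ⧸ N`, `η₁, η₂ : Γ_F →ₜ* ℤ_pˣ` unramified ⇒ de Rham.

What this file adds is the passage from the INERTIAL description of the line to the two unramified CHARACTERS
(`isDeRham_of_stable_line`): the eigen-character `a` of `Γ_F` on the line and the character `b` of `Γ_F` on the
one-dimensional quotient are continuous homomorphisms `Γ_F → ℚ_pˣ` of the COMPACT group `Γ_F`
(`absoluteGaloisGroup_compactSpace`), hence take values of norm `1`, i.e. in `ℤ_pˣ`
(`exists_continuousMonoidHom_padicInt_units`); `η₁ := a χ⁻¹` and `η₂ := b` are trivial on inertia by the inertial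
description. Consequence (`isDeRham_restrictedRationalTateRep_of_goodOrdinary`):

  **for `W/K` elliptic over a number field, `v ∣ p` of good ordinary reduction, and any `ℚ_p`-algebra structure on
  `K_v`: `V_pW|_{Γ_{K_v}}` (`restrictedRationalTateRep W (v.adicCompletion K) p`) is de Rham for `B_dR(K_v)`** —
  the instance `K₀ = K`, `F = K_v` of the cite-only fact `isDeRham_restrictedRationalTateRep` (hDR of the BSD crux K★
  `stmt-BirchSwinnertonDyer-22226`) in the good-ordinary sector. BSD is not proved by any of this; hDR stays cite-only
  (supersingular and additive/potentially-good places are not covered here).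

## References
* R. Greenberg, *Iwasawa theory for p-adic representations* (1989/1991), §2 (the ordinary filtration of `V_p(E)`). [Greenberg1991]
* J.-P. Serre, Invent. Math. 15 (1972), §1.11 Prop. 11. [SerreInventiones1972]
* S. Bloch, K. Kato (1990), Cor. 3.8.4, Example 3.9. [BlochKato1990]
* B. Perrin-Riou, *Représentations p-adiques ordinaires*, Astérisque 223 (1994), §1. [PerrinRiou1994Ordinaires]
-/

noncomputable section

open Field ValuativeRel

namespace Literature.NumberTheory.PAdicHodge

open Literature.NumberTheory.GaloisRepresentations
open Literature.NumberTheory.GaloisRepresentations.IsNonarchimedeanLocalField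
open Literature.NumberTheory.EllipticCurves WeierstrassCurve

/-! ## §1 Continuous multiplicative functions on a compact group with values in `ℚ_p` land in `ℤ_pˣ` -/

section Units

variable {Γ : Type*} [Group Γ] [TopologicalSpace Γ] [IsTopologicalGroup Γ] [CompactSpace Γ] {p : ℕ} [Fact p.Prime]

omit [IsTopologicalGroup Γ] in
/-- The values of a continuous multiplicative `a : Γ → ℚ_p` with `a 1 = 1` on a compact group have norm `1` (the
image is a bounded subgroup of `ℚ_pˣ`). [cite: SerreLocalFields1979, Ch. II §5] -/
theorem norm_eq_one_of_continuous_mul (a : Γ → ℚ_[p]) (ha : Continuous a) (h1 : a 1 = 1)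
    (hmul : ∀ σ τ, a (σ * τ) = a σ * a τ) (σ : Γ) : ‖a σ‖ = 1 := by
  have hc : Continuous fun τ : Γ => ‖a τ‖ := continuous_norm.comp ha
  obtain ⟨C, hC⟩ := (isCompact_range hc).isBounded.bddAbove
  have hpow : ∀ (τ : Γ) (n : ℕ), a (τ ^ n) = a τ ^ n := fun τ n => by
    induction n with
    | zero => rw [pow_zero, pow_zero, h1]
    | succ n ih => rw [pow_succ, hmul, ih, pow_succ]
  have hle : ∀ τ : Γ, ‖a τ‖ ≤ 1 := fun τ => not_lt.mp fun hlt => by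
    obtain ⟨n, hn⟩ := pow_unbounded_of_one_lt C hlt
    have hn' : ‖a τ‖ ^ n ≤ C := by
      have h := hC (Set.mem_range_self (τ ^ n))
      simpa only [hpow, norm_pow] using h
    exact absurd hn' (not_le.mpr hn)
  have hinv : a σ * a σ⁻¹ = 1 := by rw [← hmul, mul_inv_cancel, h1]
  have h1' : ‖a σ‖ * ‖a σ⁻¹‖ = 1 := by rw [← norm_mul, hinv, norm_one]
  refine le_antisymm (hle σ) ?_
  by_contra hlt
  rw [not_le] at hlt
  have : ‖a σ‖ * ‖a σ⁻¹‖ < 1 := by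
    calc ‖a σ‖ * ‖a σ⁻¹‖ ≤ ‖a σ‖ * 1 := by gcongr; exact hle σ⁻¹
      _ < 1 := by rw [mul_one]; exact hlt
  exact absurd h1' this.ne

/-- **A continuous multiplicative `a : Γ → ℚ_p` (`a 1 = 1`) on a compact group IS a continuous character
`Γ →ₜ* ℤ_pˣ`.** [cite: SerreLocalFields1979, Ch. II §5] -/
theorem exists_continuousMonoidHom_padicInt_units (a : Γ → ℚ_[p]) (ha : Continuous a) (h1 : a 1 = 1)
    (hmul : ∀ σ τ, a (σ * τ) = a σ * a τ) :
    ∃ η : Γ →ₜ* ℤ_[p]ˣ, ∀ σ, (((η σ : ℤ_[p]ˣ) : ℤ_[p]) : ℚ_[p]) = a σ := by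
  have hn : ∀ σ, ‖a σ‖ = 1 := norm_eq_one_of_continuous_mul a ha h1 hmul
  let f : Γ →* ℤ_[p]ˣ := MonoidHom.mk' (fun σ => PadicInt.mkUnits (hn σ)) fun σ τ => by
    refine Units.ext (Subtype.ext ?_)
    change a (σ * τ) = (((PadicInt.mkUnits (hn σ) * PadicInt.mkUnits (hn τ) : ℤ_[p]ˣ) : ℤ_[p]) : ℚ_[p])
    rw [Units.val_mul, PadicInt.coe_mul, PadicInt.mkUnits_eq, PadicInt.mkUnits_eq, hmul]
  have hval : ∀ σ, (((f σ : ℤ_[p]ˣ) : ℤ_[p]) : ℚ_[p]) = a σ := fun σ => rfl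
  have hc1 : Continuous fun σ => ((f σ : ℤ_[p]ˣ) : ℤ_[p]) := by
    have h : Continuous fun σ => (⟨a σ, (hn σ).le⟩ : ℤ_[p]) := ha.subtype_mk _
    exact h
  have hc2 : Continuous fun σ => (((f σ)⁻¹ : ℤ_[p]ˣ) : ℤ_[p]) := by
    have h : (fun σ => (((f σ)⁻¹ : ℤ_[p]ˣ) : ℤ_[p])) = fun σ => ((f σ⁻¹ : ℤ_[p]ˣ) : ℤ_[p]) := by
      funext σ; rw [map_inv]
    rw [h]
    exact hc1.comp continuous_inv
  exact ⟨⟨f, Units.continuous_iff.2 ⟨hc1, hc2⟩⟩, hval⟩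

end Units

/-! ## §2 A stable line with cyclotomic inertial action and inertially trivial quotient ⇒ de Rham -/

variable {F : Type} [Field F] [ValuativeRel F] [TopologicalSpace F] [IsNonarchimedeanLocalField F]
  [CharZero F] {p : ℕ} [Fact p.Prime] [Fact (¬ IsUnit (p : integerC F))]
  [IsAdicComplete (Ideal.span {(p : integerC F)}) (integerC F)] (hp : valuation F p < 1) [Algebra ℚ_[p] F]
  {M : Type} [AddCommGroup M] [Module ℚ_[p] M] [TopologicalSpace M] [IsTopologicalAddGroup M]
  [ContinuousSMul ℚ_[p] M] [Module.Finite ℚ_[p] M] [IsModuleTopology ℚ_[p] M]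

/-- **A representation with an inertially-cyclotomic stable line and inertially-trivial one-dimensional quotient is de
Rham** (ordinary of Hodge–Tate type `(0, −1)`). Let `ρ : Γ_F → GL(V)` be continuous, `L ≤ V` a `Γ_F`-stable line with
`dim V/L = 1`, the inertia group acting on `L` through `χ_cyclo` and trivially on `V/L`. The eigen-character of `Γ_F` on
`L` and the character on `V/L` are continuous, hence `ℤ_pˣ`-valued (`Γ_F` compact), and `η₁ = a·χ⁻¹`, `η₂ = b` are
unramified; then `isDeRham_of_ordinary`. [cite: PerrinRiou1994Ordinaires, §1] [cite: BlochKato1990, Cor. 3.8.4 and Example 3.9]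
[cite: Greenberg1991, §2 (the ordinary filtration)] -/
theorem isDeRham_of_stable_line (ρ : GaloisRep F ℚ_[p] M) (L : Submodule ℚ_[p] M)
    (hL : Module.finrank ℚ_[p] L = 1) (hQ1 : Module.finrank ℚ_[p] (M ⧸ L) = 1)
    (hstab : ∀ (σ : absoluteGaloisGroup F), ∀ x ∈ L, ρ σ x ∈ L)
    (hIL : ∀ τ ∈ absInertia F, ∀ x ∈ L,
      ρ τ x = (((GaloisRep.cyclotomicCharacter F p τ : ℤ_[p]ˣ) : ℤ_[p]) : ℚ_[p]) • x)
    (hIQ : ∀ τ ∈ absInertia F, ∀ x : M, ρ τ x - x ∈ L) :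
    GaloisRep.IsDeRham (bdRPeriodRingData (F := F) (p := p) hp) ρ := by
  classical
  haveI : CompactSpace (absoluteGaloisGroup F) := absoluteGaloisGroup_compactSpace F
  -- χ as a `ℚ_p`-valued function
  let χ : absoluteGaloisGroup F → ℚ_[p] := fun σ =>
    (((GaloisRep.cyclotomicCharacter F p σ : ℤ_[p]ˣ) : ℤ_[p]) : ℚ_[p])
  have hχmul : ∀ σ τ, χ (σ * τ) = χ σ * χ τ := fun σ τ => by
    simp only [χ, map_mul, Units.val_mul, PadicInt.coe_mul]
  have hχ1 : χ 1 = 1 := by simp only [χ, map_one, Units.val_one, PadicInt.coe_one]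
  have hχ0 : ∀ σ, χ σ ≠ 0 := fun σ =>
    PadicInt.coe_ne_zero.2 (GaloisRep.cyclotomicCharacter F p σ).ne_zero
  have hχcont : Continuous χ := by
    have h1 : Continuous fun σ => ((GaloisRep.cyclotomicCharacter F p σ : ℤ_[p]ˣ) : ℤ_[p]) :=
      Units.continuous_val.comp (GaloisRep.cyclotomicCharacter F p).continuous
    have h2 : Continuous (fun z : ℤ_[p] => (z : ℚ_[p])) := continuous_subtype_val
    exact h2.comp h1
  -- (1) a generator `ℓ₀` of the line and the eigen-character `a`
  obtain ⟨v₀, hv₀, hgen⟩ := finrank_eq_one_iff'.1 hL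
  set ℓ₀ : M := (v₀ : M) with hℓ₀def
  have hℓ₀ : ℓ₀ ≠ 0 := fun h => hv₀ (Subtype.ext h)
  have hℓ₀L : ℓ₀ ∈ L := v₀.2
  have hgen' : ∀ x ∈ L, ∃ c : ℚ_[p], c • ℓ₀ = x := fun x hx => by
    obtain ⟨c, hc⟩ := hgen ⟨x, hx⟩
    exact ⟨c, by simpa only [hℓ₀def, Submodule.coe_smul] using congrArg Subtype.val hc⟩
  choose a ha using fun σ => hgen' (ρ σ ℓ₀) (hstab σ ℓ₀ hℓ₀L)
  -- `a σ • ℓ₀ = ρ σ ℓ₀`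
  have hamul : ∀ σ τ, a (σ * τ) = a σ * a τ := fun σ τ => by
    apply smul_left_injective ℚ_[p] hℓ₀
    change a (σ * τ) • ℓ₀ = (a σ * a τ) • ℓ₀
    rw [ha, map_mul, Module.End.mul_apply, ← ha τ, map_smul, ← ha σ, smul_smul, mul_comm]
  have ha1 : a 1 = 1 := by
    apply smul_left_injective ℚ_[p] hℓ₀
    change a 1 • ℓ₀ = (1 : ℚ_[p]) • ℓ₀
    rw [ha, map_one, Module.End.one_apply, one_smul]
  -- a linear functional with `g ℓ₀ = 1`, for continuity of `a`
  obtain ⟨g, hg⟩ := LinearMap.exists_extend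
    (LinearEquiv.coord ℚ_[p] M ℓ₀ hℓ₀ : (ℚ_[p] ∙ ℓ₀) →ₗ[ℚ_[p]] ℚ_[p])
  have hgℓ₀ : g ℓ₀ = 1 := by
    have h := LinearMap.congr_fun hg ⟨ℓ₀, Submodule.mem_span_singleton_self ℓ₀⟩
    rw [LinearMap.comp_apply, Submodule.subtype_apply] at h
    rw [h]
    exact LinearEquiv.coord_self ℚ_[p] M ℓ₀ hℓ₀
  have haeq : ∀ σ, a σ = g (ρ σ ℓ₀) := fun σ => by rw [← ha σ, map_smul, hgℓ₀, smul_eq_mul, mul_one]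
  have hacont : Continuous a := by
    have h : a = fun σ => g (ρ σ ℓ₀) := funext haeq
    rw [h]
    exact (IsModuleTopology.continuous_of_linearMap g).comp (ρ.continuous_apply_left ℓ₀)
  -- on inertia `a = χ`
  have haI : ∀ τ ∈ absInertia F, a τ = χ τ := fun τ hτ => by
    apply smul_left_injective ℚ_[p] hℓ₀
    change a τ • ℓ₀ = χ τ • ℓ₀
    rw [ha, hIL τ hτ ℓ₀ hℓ₀L]
  -- `η₁ := a χ⁻¹`
  obtain ⟨η₁, hη₁⟩ := exists_continuousMonoidHom_padicInt_units (fun σ => a σ * (χ σ)⁻¹)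
    (hacont.mul (hχcont.inv₀ hχ0)) (by simp only [ha1, hχ1, inv_one, mul_one]) (fun σ τ => by
      simp only [hamul, hχmul, mul_inv]; ring)
  -- (2) the quotient character `b`
  obtain ⟨q₀, hq₀, hgenQ⟩ := finrank_eq_one_iff'.1 hQ1
  obtain ⟨m₀, hm₀⟩ := L.mkQ_surjective q₀
  have hstab' : ∀ σ, L ≤ L.comap (ρ σ : M →ₗ[ℚ_[p]] M) := fun σ x hx => hstab σ x hx
  have hgenQ' : ∀ q : M ⧸ L, ∃ c : ℚ_[p], c • q₀ = q := hgenQ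
  choose b hb using fun σ => hgenQ' (L.mapQ L (ρ σ : M →ₗ[ℚ_[p]] M) (hstab' σ) q₀)
  -- `b σ • q₀ = [ρ σ m₀]`, hence `[ρ σ m] = b σ • [m]` for all `m`
  have hbq : ∀ (σ) (m : M), L.mkQ (ρ σ m) = b σ • L.mkQ m := fun σ m => by
    obtain ⟨c, hc⟩ := hgenQ' (L.mkQ m)
    have h1 : L.mapQ L (ρ σ : M →ₗ[ℚ_[p]] M) (hstab' σ) (L.mkQ m) = L.mkQ (ρ σ m) := rfl
    rw [← h1, ← hc, map_smul, ← hb σ, smul_smul, smul_smul, mul_comm]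
  have hbmul : ∀ σ τ, b (σ * τ) = b σ * b τ := fun σ τ => by
    apply smul_left_injective ℚ_[p] hq₀
    change b (σ * τ) • q₀ = (b σ * b τ) • q₀
    have h := hbq (σ * τ) m₀
    rw [hm₀] at h
    rw [← h, map_mul, Module.End.mul_apply, hbq σ, hbq τ, hm₀, smul_smul]
  have hb1 : b 1 = 1 := by
    apply smul_left_injective ℚ_[p] hq₀
    change b 1 • q₀ = (1 : ℚ_[p]) • q₀
    have h := hbq 1 m₀
    rw [hm₀, map_one, Module.End.one_apply, hm₀] at h
    rw [← h, one_smul]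
  -- continuity of `b` through a functional `g' ∘ mkQ` with `g' q₀ = 1`
  obtain ⟨g', hg'⟩ := LinearMap.exists_extend
    (LinearEquiv.coord ℚ_[p] (M ⧸ L) q₀ hq₀ : (ℚ_[p] ∙ q₀) →ₗ[ℚ_[p]] ℚ_[p])
  have hg'q₀ : g' q₀ = 1 := by
    have h := LinearMap.congr_fun hg' ⟨q₀, Submodule.mem_span_singleton_self q₀⟩
    rw [LinearMap.comp_apply, Submodule.subtype_apply] at h
    rw [h]
    exact LinearEquiv.coord_self ℚ_[p] (M ⧸ L) q₀ hq₀
  have hbeq : ∀ σ, b σ = (g'.comp L.mkQ) (ρ σ m₀) := fun σ => by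
    rw [LinearMap.comp_apply, hbq σ m₀, hm₀, map_smul, hg'q₀, smul_eq_mul, mul_one]
  have hbcont : Continuous b := by
    have h : b = fun σ => (g'.comp L.mkQ) (ρ σ m₀) := funext hbeq
    rw [h]
    exact (IsModuleTopology.continuous_of_linearMap (g'.comp L.mkQ)).comp (ρ.continuous_apply_left m₀)
  -- on inertia `b = 1`
  have hbI : ∀ τ ∈ absInertia F, b τ = 1 := fun τ hτ => by
    apply smul_left_injective ℚ_[p] hq₀
    change b τ • q₀ = (1 : ℚ_[p]) • q₀
    have h := hbq τ m₀
    rw [hm₀] at h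
    have h2 : L.mkQ (ρ τ m₀) = L.mkQ m₀ := by
      rw [← sub_eq_zero, ← map_sub, Submodule.mkQ_apply, Submodule.Quotient.mk_eq_zero]
      exact hIQ τ hτ m₀
    rw [← h, h2, hm₀, one_smul]
  obtain ⟨η₂, hη₂⟩ := exists_continuousMonoidHom_padicInt_units b hbcont hb1 hbmul
  -- (3) feed `isDeRham_of_ordinary`
  have hcoe : ∀ (u v : ℤ_[p]ˣ), (((u * v : ℤ_[p]ˣ) : ℤ_[p]) : ℚ_[p]) =
      (((u : ℤ_[p]ˣ) : ℤ_[p]) : ℚ_[p]) * (((v : ℤ_[p]ˣ) : ℤ_[p]) : ℚ_[p]) := fun u v => by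
    rw [Units.val_mul, PadicInt.coe_mul]
  have hunit_eq_one : ∀ (u : ℤ_[p]ˣ), (((u : ℤ_[p]ˣ) : ℤ_[p]) : ℚ_[p]) = 1 → u = 1 := fun u hu => by
    have h : ((u : ℤ_[p]ˣ) : ℤ_[p]) = 1 := Subtype.ext (hu.trans PadicInt.coe_one.symm)
    exact Units.val_eq_one.1 h
  refine isDeRham_of_ordinary hp ρ L η₁ η₂ (fun τ hτ => hunit_eq_one _ ?_) (fun τ hτ => hunit_eq_one _ ?_)
    (fun σ n hn => ?_) (fun σ m => ?_)
  · rw [hη₁, haI τ hτ, mul_inv_cancel₀ (hχ0 τ)]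
  · rw [hη₂, hbI τ hτ]
  · obtain ⟨c, rfl⟩ := hgen' n hn
    rw [hcoe, hη₁, inv_mul_cancel_right₀ (hχ0 σ), map_smul, ← ha σ, smul_smul, smul_smul, mul_comm]
  · rw [← Submodule.Quotient.mk_eq_zero, ← Submodule.mkQ_apply, map_sub, map_smul, hbq σ m, hη₂, sub_self]

/-! ## §3 Elliptic curves over number fields at a place of good ordinary reduction -/

/-- **`V_pW|_{Γ_{K_v}}` is de Rham at a place `v ∣ p` of good ORDINARY reduction** (`W` an elliptic curve over a number
field `K`, `p ∤ a_v`), for Fontaine's `B_dR(K_v)` and any `ℚ_p`-algebra structure on `K_v`: the good-ordinary sector of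
the cite-only fact `isDeRham_restrictedRationalTateRep` at `K₀ = K`, `F = K_v`, from the tree theorems
`ellipticOrdinaryReduction_tateModule_filtration_holds` (the ordinary line) and `isDeRham_of_ordinary`.
[cite: Greenberg1991, §2 (the ordinary filtration)] [cite: BlochKato1990, Cor. 3.8.4 and Example 3.9]
[cite: PerrinRiou1994Ordinaires, §1] -/
theorem isDeRham_restrictedRationalTateRep_of_goodOrdinary {K : Type} [Field K] [NumberField K]
    (W : WeierstrassCurve K) [W.IsElliptic] (v : IsDedekindDomain.HeightOneSpectrum (NumberField.RingOfIntegers K))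
    (hv : (p : NumberField.RingOfIntegers K) ∈ v.asIdeal) (hgood : W.HasGoodReductionAt v)
    (hord : ¬ ((p : ℤ) ∣ W.frobeniusTraceAt v))
    [CharZero (v.adicCompletion K)] [Fact (¬ IsUnit (p : integerC (v.adicCompletion K)))]
    [IsAdicComplete (Ideal.span {(p : integerC (v.adicCompletion K))}) (integerC (v.adicCompletion K))]
    (hp : valuation (v.adicCompletion K) p < 1) [Algebra ℚ_[p] (v.adicCompletion K)] :
    GaloisRep.IsDeRham (bdRPeriodRingData (F := v.adicCompletion K) (p := p) hp)
      (restrictedRationalTateRep W (v.adicCompletion K) p) := by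
  have hpK : (p : K) ≠ 0 := Nat.cast_ne_zero.mpr (Fact.out : p.Prime).ne_zero
  haveI : Module.Finite ℚ_[p] (W.rationalTateModule p) := module_finite_rationalTateModule_holds W p
  have h2 : Module.finrank ℚ_[p] (W.rationalTateModule p) = 2 := finrank_rationalTateModule_eq_two_holds W p hpK
  obtain ⟨L, hL1, hstab, hIL, hIQ⟩ := ellipticOrdinaryReduction_tateModule_filtration_holds W p v hv hgood hord
  have hQ1 : Module.finrank ℚ_[p] (W.rationalTateModule p ⧸ L) = 1 := by
    have h := L.finrank_quotient_add_finrank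
    omega
  exact isDeRham_of_stable_line hp (restrictedRationalTateRep W (v.adicCompletion K) p) L hL1 hQ1
    (fun σ x hx => hstab σ x hx) (fun τ hτ x hx => hIL τ hτ x hx) (fun τ hτ x => hIQ τ hτ x)

end Literature.NumberTheory.PAdicHodge

end
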